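import Literature.AnabelianGeometry.EtaleTheta.SettingModelTateSemidirect
import Literature.AnabelianGeometry.EtaleTheta.SettingModelCyclotomicCharacterPadicSurjective
import Literature.AnabelianGeometry.EtaleTheta.SettingModelCycEquivContinuous
import Literature.AnabelianGeometry.AbsoluteAnabelian.MLFGaloisElasticProofs
import Literature.AnabelianGeometry.SemiGraphs.TemperedCurveDataNonVacuity
import HarnessLib

/-!
# The stage-2 Tate character pair `σ ↦ ((κ_p σ^i, κ_p σ^j), χ σ)` is NOT injective on `G_{ℚ_p}`
# (`Ker (tatePairHom p i j) ≠ ⊥`) — the last binder `hI0` of hΔX at the [EtTh] Tate model, DISCHARGED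

S. Mochizuki, *The étale theta function …*, Publ. RIMS **45** (2009) [EtTh], §1 p. 13 (the `G_K`-action on `Π_X` through the
cyclotomic character and the Kummer class of the `q`-parameter) [cite: MochizukiEtTh2009, §1 p.13]; S. Mochizuki, *Topics in Absolute
Anabelian Geometry I*, Thm 1.7 (ii) p. 14 («`G_k` is elastic» for an MLF `k`) [cite: MochizukiAbsTopI2012, Thm 1.7 (ii) p.14];
L. Ribes, P. Zalesskii, *Profinite Groups*, Thm 2.7.1 (`Ẑ`) [cite: RibesZalesskii2010, Thm 2.7.1].

Cell `abc-iut`, seat abc-iut-w4-d044 (gen 7), row «HI0-DISCHARGE» (abc-iut-L6-lead §F v1.19cw; sequel of this seat's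
`ThetaSettingCompletionPackageGeomIdent.lean` p486362 whose only residual binder is `hI0`).  PROOF-ONLY (0 defs / instances / named
facts).  ROUTE (pure profinite group theory on the tree's THEOREMS about the GENUINE `G_{ℚ_p} = Gal(ℚ̄_p/ℚ_p)`; no element of `ℚ̄_p`
is exhibited): if `Ker = ⊥` then `κ_p` is injective on `Ker χ`; some `τ ∈ Ker χ` has `κ_p τ ≠ 1` (else `χ` embeds `G_{ℚ_p}` in the
COMMUTATIVE `Aut(Ẑ)`, contradicting slimness, [pGC] Lem 15.8 `isSlimGroup_GQp`); `T :=` the closure of `⟨τ⟩` is closed, topologically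
finitely generated, inside `Ker χ`, and NORMAL — since `κ_p(στσ⁻¹) = χ(σ)·κ_p(τ)` and **every automorphism of `Ẑ` maps `x` into the
closure of `⟨x⟩`** (`SettingModel.mulAut_apply_mem_closure_zpowers`, from abc-iut's `ZHatLevel.powEnd` / `toAdd_level_aut` /
`ext_of_level` and the density of `ℤ` in `Ẑ`); then ELASTICITY of `G_{ℚ_p}` (`isElastic_absoluteGaloisGroup`, [AbsTopI] Thm 1.7 (ii),
a tree theorem) makes `T` of finite index, whence `χ` has finite image — but `χ ↠ ℤ_p^×` (`exists_padicCharUnits_chi_eq`) and `1 + p`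
has infinite order.

WHAT IS SHOWN: `SettingModel.mulAut_apply_mem_closure_zpowers` (Lemma Z); `SettingModel.mulAut_ZH_comm` (`Aut(Ẑ)` is commutative);
`SettingModel.isClosed_ker_chi`; `SettingModel.not_finiteIndex_ker_chi`; **`SettingModel.ker_tatePairHom_ne_bot :
(tatePairHom p i j).ker ≠ ⊥`** for ALL `i j` (the kernel contains `I_χ := Ker κ_p ∩ Ker χ ≠ 1`).

HONEST FRAMING: statements about OUR model's genuine characters `chi`, `kappaP` on `Gal(ℚ̄_p/ℚ_p)`; classical; nothing here bears on
[IUTchIII] Cor. 3.12 or takes a side; typed ≠ proved elsewhere; nothing asserts abc proved or refuted.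
-/

noncomputable section

open CategoryTheory ProfiniteGrp ProfiniteGrp.ProfiniteCompletion

namespace Literature.AnabelianGeometry.EtaleTheta.SettingModel

open Literature.AnabelianGeometry.SemiGraphs
open Literature.AnabelianGeometry.AbsoluteAnabelian
open Literature.AlgebraicGeometry.Frobenioids (IsSlimGroup)

/-! ### Lemma Z: automorphisms of `Ẑ` preserve the closure of every cyclic subgroup -/

/-- The level maps `Ẑ → ℤ/n` are locally constant (their kernels are open). [cite: RibesZalesskii2010, Thm 2.7.1] -/
private theorem isLocallyConstant_zhatLevel (n : ℕ+) : IsLocallyConstant (ZHatLevel.level n : ZH → Multiplicative (ZMod n)) := by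
  refine (IsLocallyConstant.iff_exists_open _).2 fun u => ⟨{u' : ZH | u⁻¹ * u' ∈ (ZHatLevel.level n).ker}, ?_, ?_, ?_⟩
  · exact (ZHatLevel.isOpen_ker_level n).preimage (continuous_const.mul continuous_id)
  · change u⁻¹ * u ∈ (ZHatLevel.level n).ker
    rw [inv_mul_cancel]
    exact one_mem _
  · intro u' hu'
    change u⁻¹ * u' ∈ (ZHatLevel.level n).ker at hu'
    rw [MonoidHom.mem_ker, map_mul, map_inv, inv_mul_eq_one] at hu'
    exact hu'.symm

/-- **Lemma Z: every automorphism `φ` of the abstract group `Ẑ` maps each `x ∈ Ẑ` into the CLOSURE of `⟨x⟩`** (`φ(x) = x^u` with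
`u = φ(1) ∈ Ẑ`, a limit of integer powers: the exponentiation `u ↦ x^u` (`ZHatLevel.powEnd`) is continuous in `u`, agrees with
`k ↦ x^k` on the dense `ℤ ⊆ Ẑ`, and `φ x = x^{φ(1)}` by `toAdd_level_aut`/`ext_of_level`). [cite: RibesZalesskii2010, Thm 2.7.1] -/
theorem mulAut_apply_mem_closure_zpowers (φ : MulAut ZH) (x : ZH) :
    φ x ∈ closure ((Subgroup.zpowers x : Subgroup ZH) : Set ZH) := by
  let Ψ : ZH → ZH := fun u => ZHatLevel.powEnd (ZHatLevel.LevelFamily.ofZHat u) x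
  have hΨlvl : ∀ (n : ℕ+) (u : ZH), Multiplicative.toAdd (ZHatLevel.level n (Ψ u)) =
      Multiplicative.toAdd (ZHatLevel.level n u) * Multiplicative.toAdd (ZHatLevel.level n x) :=
    fun n u => ZHatLevel.toAdd_level_powEnd _ n x
  have hΨc : Continuous Ψ := ZHatLevel.continuous_of_isLocallyConstant_level Ψ fun n => by
    have h := (isLocallyConstant_zhatLevel n).comp
      (fun c => Multiplicative.ofAdd (Multiplicative.toAdd c * Multiplicative.toAdd (ZHatLevel.level n x)))
    convert h using 1
    funext u
    apply Multiplicative.toAdd.injective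
    rw [hΨlvl]
    rfl
  have hΨeta : ∀ k : ℤ, Ψ (ZHatLevel.eta k) = x ^ k := fun k => ZHatLevel.ext_of_level fun n => by
    apply Multiplicative.toAdd.injective
    rw [hΨlvl, ZHatLevel.level_eta, toAdd_ofAdd, map_zpow, toAdd_zpow, zsmul_eq_mul]
  have hφ : φ x = Ψ (φ (ZHatLevel.eta 1)) := ZHatLevel.ext_of_level fun n => by
    apply Multiplicative.toAdd.injective
    rw [ZHatLevel.toAdd_level_aut, hΨlvl, ZHatLevel.levelChar_apply]
  rw [hφ]
  -- `φ (η 1)` lies in the closure of `η(ℤ)` (= everything); push through the continuous `Ψ`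
  have hdense : (φ (ZHatLevel.eta 1) : ZH) ∈ closure (Set.range fun k : ℤ => ZHatLevel.eta k) := by
    have hd := ProfiniteGrp.ProfiniteCompletion.denseRange (GrpCat.of (Multiplicative ℤ))
    have : Set.range (fun k : ℤ => ZHatLevel.eta k) = Set.range (etaFn (GrpCat.of (Multiplicative ℤ))) := by
      ext z
      constructor
      · rintro ⟨k, rfl⟩; exact ⟨Multiplicative.ofAdd k, rfl⟩
      · rintro ⟨m, rfl⟩; exact ⟨Multiplicative.toAdd m, rfl⟩
    rw [this]
    exact hd _
  have h1 : Ψ (φ (ZHatLevel.eta 1)) ∈ closure (Ψ '' Set.range fun k : ℤ => ZHatLevel.eta k) :=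
    image_closure_subset_closure_image hΨc ⟨_, hdense, rfl⟩
  refine closure_mono ?_ h1
  rintro _ ⟨_, ⟨k, rfl⟩, rfl⟩
  rw [hΨeta]
  exact ⟨k, rfl⟩

/-- `Aut(Ẑ) = Ẑ^×` is commutative (automorphisms are determined by their level characters, which multiply in the commutative
`ℤ/n`). [cite: RibesZalesskii2010, Thm 2.7.1] -/
theorem mulAut_ZH_comm (φ ψ : MulAut ZH) : φ * ψ = ψ * φ :=
  ZHatLevel.eq_of_levelChar_eq fun n => by rw [map_mul, map_mul, mul_comm]

variable (p : ℕ) [Fact p.Prime]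

/-! ### `Ker χ`: closed, of infinite index -/

/-- `σ ∈ Ker χ` iff all level characters of `χ σ` are `1`. [cite: MochizukiEtTh2009, §1 p.13] -/
theorem mem_ker_chi_iff (σ : GQp p) : σ ∈ (chi p).ker ↔ ∀ n : ℕ+, ZHatLevel.levelChar n (chi p σ) = 1 := by
  rw [MonoidHom.mem_ker]
  constructor
  · intro h n
    rw [h, map_one]
  · intro h
    exact ZHatLevel.eq_of_levelChar_eq fun n => by rw [h n, map_one]

/-- `Ker χ ≤ G_{ℚ_p}` is closed. [cite: MochizukiEtTh2009, §1 p.13] -/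
theorem isClosed_ker_chi : IsClosed (((chi p).ker : Subgroup (GQp p)) : Set (GQp p)) := by
  have : (((chi p).ker : Subgroup (GQp p)) : Set (GQp p)) = ⋂ n : ℕ+, {σ | ZHatLevel.levelChar n (chi p σ) = 1} := by
    ext σ
    rw [SetLike.mem_coe, mem_ker_chi_iff, Set.mem_iInter]
    rfl
  rw [this]
  exact isClosed_iInter fun n => isClosed_setOf_levelChar_chi_eq p n 1

/-- `1 + p ∈ ℤ_p` is a unit of infinite order: `(1 + p)^m ≠ 1` for `m ≥ 1`. [cite: NeukirchANT1999, Ch. II §5] -/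
private theorem one_add_p_pow_ne_one {m : ℕ} (hm : 0 < m) : ((1 + p : ℤ_[p])) ^ m ≠ 1 := by
  intro h
  have h' : ((1 + p : ℕ) : ℤ_[p]) ^ m = ((1 : ℕ) : ℤ_[p]) := by push_cast; exact h
  rw [← Nat.cast_pow, Nat.cast_inj] at h'
  have : 1 < (1 + p) ^ m := Nat.one_lt_pow hm.ne' (by have := (Fact.out : p.Prime).one_lt; omega)
  omega

/-- **`Ker χ` has INFINITE index in `G_{ℚ_p}`**: `χ` maps onto `ℤ_p^×` (`exists_padicCharUnits_chi_eq`), which contains the element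
`1 + p` of infinite order. [cite: NeukirchANT1999, Ch. II §5] -/
theorem not_finiteIndex_ker_chi : ¬ ((chi p).ker : Subgroup (GQp p)).FiniteIndex := by
  intro hfi
  set m := ((chi p).ker : Subgroup (GQp p)).index with hm
  have hm0 : 0 < m := Nat.pos_of_ne_zero hfi.index_ne_zero
  -- the unit `1 + p`
  have hu : IsUnit ((1 + p : ℤ_[p])) := by
    rw [PadicInt.isUnit_iff]
    have h1 : ‖(1 : ℤ_[p])‖ = 1 := norm_one
    have hp : ‖(p : ℤ_[p])‖ < 1 := by
      rw [PadicInt.norm_p]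
      exact inv_lt_one_of_one_lt₀ (by exact_mod_cast (Fact.out : p.Prime).one_lt)
    rw [PadicInt.norm_add_eq_max_of_ne (by rw [h1]; exact hp.ne'), h1, max_eq_left hp.le]
  obtain ⟨σ, hσ⟩ := exists_padicCharUnits_chi_eq p hu.unit
  -- `σ^m ∈ Ker χ`
  have hσm : σ ^ m ∈ (chi p).ker := by rw [hm]; exact Subgroup.pow_index_mem _ σ
  have h1 : ZHatLevel.padicCharUnits p (chi p (σ ^ m)) = 1 := by
    rw [MonoidHom.mem_ker.mp hσm, map_one]
  rw [map_pow, map_pow, hσ] at h1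
  have h2 := congrArg (fun u : ℤ_[p]ˣ => (u : ℤ_[p])) h1
  simp only [Units.val_pow_eq_pow_val, IsUnit.unit_spec, Units.val_one] at h2
  exact one_add_p_pow_ne_one p hm0 h2

/-! ### The theorem -/

/-- **`Ker (tatePairHom p i j) ≠ ⊥`: the stage-2 Tate character pair is not injective on `G_{ℚ_p}`** — equivalently
`I_χ = Ker κ_p ∩ Ker χ = Gal(ℚ̄_p/ℚ_p(μ_∞, p^{1/∞})) ≠ 1`; the binder `hI0` of this seat's
`deltaX_characteristic_setting_modelχq_of_ker_ne_bot'` (p486362).  Proof by elasticity + slimness of `G_{ℚ_p}` and Lemma Z; see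
the module docstring. [cite: MochizukiAbsTopI2012, Thm 1.7 (ii) p.14] -/
theorem ker_tatePairHom_ne_bot (i j : ℤ) : (tatePairHom p i j).ker ≠ ⊥ := by
  classical
  intro hbot
  haveI : IsGalois ℚ_[p] (AlgebraicClosure ℚ_[p]) := {}
  haveI : T2Space (GQp p) := krullTopology_t2
  set K : Subgroup (GQp p) := (chi p).ker with hKdef
  haveI hKn : K.Normal := MonoidHom.normal_ker _
  -- (a) `κ_p` is injective on `K = Ker χ`
  have hinj : ∀ σ : GQp p, σ ∈ K → kappaP p σ = 1 → σ = 1 := by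
    intro σ hχ hκ
    have hmem : σ ∈ (tatePairHom p i j).ker := by
      rw [MonoidHom.mem_ker]
      refine SemidirectProduct.ext ?_ ?_
      · rw [cocyclePairHom_left, hκ, one_zpow, one_zpow]
        rfl
      · rw [cocyclePairHom_right, MonoidHom.mem_ker.mp hχ]
        rfl
    rwa [hbot, Subgroup.mem_bot] at hmem
  -- `κ_p` is multiplicative on `K`; conjugation formula
  have hmul : ∀ σ τ : GQp p, σ ∈ K → kappaP p (σ * τ) = kappaP p σ * kappaP p τ := by
    intro σ τ hσ
    rw [kappaP_mul, MonoidHom.mem_ker.mp hσ, MulAut.one_apply]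
  let κK : K →* ZH :=
    { toFun := fun σ => kappaP p σ
      map_one' := kappaP_one p
      map_mul' := fun a b => hmul a b a.2 }
  have hκK : ∀ σ : K, κK σ = kappaP p σ := fun _ => rfl
  have hconj : ∀ σ τ : GQp p, τ ∈ K → kappaP p (σ * τ * σ⁻¹) = chi p σ (kappaP p τ) := by
    intro σ τ hτ
    have hn : σ * τ * σ⁻¹ ∈ K := hKn.conj_mem τ hτ σ
    have e1 : kappaP p (σ * τ * σ⁻¹ * σ) = kappaP p (σ * τ * σ⁻¹) * kappaP p σ := by
      rw [kappaP_mul, MonoidHom.mem_ker.mp hn, MulAut.one_apply]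
    rw [inv_mul_cancel_right, kappaP_mul, ZHatCompletion.mul_comm (kappaP p σ)] at e1
    exact (mul_right_cancel e1).symm
  -- (b) some `τ ∈ K` has `κ_p τ ≠ 1`
  have hτ : ∃ τ ∈ K, kappaP p τ ≠ 1 := by
    by_contra hall
    push Not at hall
    have hK : K = ⊥ := (Subgroup.eq_bot_iff_forall _).2 fun τ hτ => hinj τ hτ (hall τ hτ)
    have hcomm : ∀ a b : GQp p, a * b = b * a := by
      intro a b
      have hmem : a * b * (b * a)⁻¹ ∈ K := by
        rw [MonoidHom.mem_ker, map_mul, map_mul, map_inv, map_mul, mulAut_ZH_comm (chi p b), mul_inv_cancel]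
      rw [hK, Subgroup.mem_bot, mul_inv_eq_one] at hmem
      exact hmem
    have hZ := (TemperedCurve.isSlimGroup_GQp (p := p)).centralizer_eq_bot ⊤ isOpen_univ
    obtain ⟨σ, n, hσ⟩ := exists_levelChar_chi_ne_one p
    apply hσ
    have hσ1 : σ = 1 := by
      have : σ ∈ Subgroup.centralizer ((⊤ : Subgroup (GQp p)) : Set (GQp p)) :=
        Subgroup.mem_centralizer_iff.2 fun h _ => hcomm h σ
      rw [hZ] at this
      exact Subgroup.mem_bot.mp this
    rw [hσ1, map_one, map_one]
  obtain ⟨τ, hτK, hτ1⟩ := hτ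
  -- (c) `T := closure ⟨τ⟩`: closed, inside `K`
  set T : Subgroup (GQp p) := (Subgroup.zpowers τ).topologicalClosure with hTdef
  have hTc : IsClosed (T : Set (GQp p)) := Subgroup.isClosed_topologicalClosure _
  have hKc : IsClosed (K : Set (GQp p)) := isClosed_ker_chi p
  have hτT : τ ∈ T := Subgroup.le_topologicalClosure _ (Subgroup.mem_zpowers τ)
  have hTK : T ≤ K := Subgroup.topologicalClosure_minimal _ ((Subgroup.zpowers_le).mpr hτK) hKc
  -- `κ_p` is continuous; `κ_p(T)` is closed and contains the closure of `⟨κ_p τ⟩`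
  have hκc : Continuous (kappaP p) :=
    ZHatLevel.continuous_of_isLocallyConstant_level _ (isLocallyConstant_level_kappaP p)
  have hpow : ∀ k : ℤ, kappaP p (τ ^ k) = kappaP p τ ^ k := fun k => by
    have h := map_zpow κK ⟨τ, hτK⟩ k
    rwa [hκK, hκK] at h
  have himage : closure ((Subgroup.zpowers (kappaP p τ) : Subgroup ZH) : Set ZH) ⊆ kappaP p '' (T : Set (GQp p)) := by
    refine closure_minimal ?_ ((hTc.isCompact.image hκc).isClosed)
    intro y hy
    obtain ⟨k, rfl⟩ := Subgroup.mem_zpowers_iff.mp hy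
    exact ⟨τ ^ k, Subgroup.le_topologicalClosure _ (Subgroup.mem_zpowers_iff.mpr ⟨k, rfl⟩), hpow k⟩
  -- normality: the generator's conjugates lie in `T` (Lemma Z + injectivity of `κ_p` on `K`) …
  have hgen : ∀ σ : GQp p, σ * τ * σ⁻¹ ∈ T := by
    intro σ
    have hn : σ * τ * σ⁻¹ ∈ K := hKn.conj_mem τ hτK σ
    have hz := mulAut_apply_mem_closure_zpowers (chi p σ) (kappaP p τ)
    rw [← hconj σ τ hτK] at hz
    obtain ⟨t, htT, ht⟩ := himage hz
    -- `t⁻¹ (στσ⁻¹) ∈ K` has trivial `κ_p`, hence is trivial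
    have htK : t ∈ K := hTK htT
    have h1 : kappaP p (t⁻¹ * (σ * τ * σ⁻¹)) = 1 := by
      rw [hmul _ _ (inv_mem htK), ← ht]
      have hti : kappaP p t⁻¹ * kappaP p t = 1 := by rw [← hmul _ _ (inv_mem htK), inv_mul_cancel, kappaP_one]
      exact hti
    have h2 := hinj _ (mul_mem (inv_mem htK) hn) h1
    rw [inv_mul_eq_one] at h2
    rw [← h2]
    exact htT
  -- … hence all of `T` is normalised
  have hTn : T.Normal := by
    refine ⟨fun t ht σ => ?_⟩
    -- the closed subgroup `{x | σ x σ⁻¹ ∈ T}` contains `⟨τ⟩`, hence `T`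
    let c : GQp p ≃ₜ* GQp p :=
      { MulAut.conj σ with
        continuous_toFun := (continuous_const.mul continuous_id).mul continuous_const
        continuous_invFun := (continuous_const.mul continuous_id).mul continuous_const }
    have hc : ∀ x, c x = σ * x * σ⁻¹ := fun _ => rfl
    have hle : Subgroup.zpowers τ ≤ T.comap c.toMulEquiv.toMonoidHom := by
      rw [Subgroup.zpowers_le, Subgroup.mem_comap]
      exact hgen σ
    have hclosed : IsClosed ((T.comap c.toMulEquiv.toMonoidHom : Subgroup (GQp p)) : Set (GQp p)) :=
      hTc.preimage c.continuous
    have := Subgroup.topologicalClosure_minimal _ hle hclosed ht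
    rw [Subgroup.mem_comap] at this
    exact this
  -- `T` is topologically finitely generated (by `τ`)
  have hTfg : IsTopologicallyFinitelyGenerated T := by
    refine ⟨⟨{⟨τ, hτT⟩}, ?_⟩⟩
    rw [Finset.coe_singleton, eq_top_iff]
    rintro ⟨x, hx⟩ -
    rw [← Subgroup.zpowers_eq_closure, ← SetLike.mem_coe, Subgroup.topologicalClosure_coe,
      Topology.IsInducing.subtypeVal.closure_eq_preimage_closure_image, Set.mem_preimage]
    have himg : (Subtype.val '' ((Subgroup.zpowers (⟨τ, hτT⟩ : T) : Subgroup T) : Set T)) =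
        ((Subgroup.zpowers τ : Subgroup (GQp p)) : Set (GQp p)) := by
      ext y
      constructor
      · rintro ⟨z, hz, rfl⟩
        obtain ⟨k, rfl⟩ := Subgroup.mem_zpowers_iff.mp hz
        exact Subgroup.mem_zpowers_iff.mpr ⟨k, by rw [Subgroup.coe_zpow]⟩
      · intro hy
        obtain ⟨k, rfl⟩ := Subgroup.mem_zpowers_iff.mp hy
        exact ⟨⟨τ, hτT⟩ ^ k, Subgroup.mem_zpowers_iff.mpr ⟨k, rfl⟩, by rw [Subgroup.coe_zpow]⟩
    change x ∈ closure (Subtype.val '' ((Subgroup.zpowers (⟨τ, hτT⟩ : T) : Subgroup T) : Set T))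
    rw [himg, ← Subgroup.topologicalClosure_coe]
    exact hx
  -- (d) elasticity of `G_{ℚ_p}`
  have hT' : (T.subgroupOf ⊤).Normal := hTn.subgroupOf ⊤
  rcases (isElastic_absoluteGaloisGroup p ℚ_[p]).eq_bot_or_finiteIndex ⊤ T isOpen_univ le_top hT' hTc hTfg with
    hT0 | hTfi
  · apply hτ1
    have hτ0 : τ = 1 := by
      rw [hT0] at hτT
      exact Subgroup.mem_bot.mp hτT
    rw [hτ0, kappaP_one]
  · haveI := hTfi
    exact not_finiteIndex_ker_chi p (@Subgroup.finiteIndex_of_le _ _ T K hTfi hTK)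

end Literature.AnabelianGeometry.EtaleTheta.SettingModel

end
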